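import Mathlib
import Summits.NavierStokesRegularity.NavierStokesRegularity.Theorems.HeteroclinicTriggerChainTriggerChainFrontStepConnectionAlgebra
import HarnessLib

/-!
# `HeteroclinicTriggerChain` — crux `TriggerChainFrontStep` (item stmt-NavierStokesRegularity-22785):
  SECTOR ROWS — the cascade nonlinearity on families charging only the carrier and trigger modes

A chain state of the route charges, at every shell `n`, only the carrier mode `i₀` (amplitude `x_n`) and the
trigger mode `i₁` (amplitude `u_n`). For such SECTOR FAMILIES (`X j n ≡ 0` for `j ∉ {i₀,i₁}`, all shells)
and a table in normal form at the pure-mode saddle (`stub_normal_form`) obeying the (parity) clause and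
with NO trigger self-interaction into junk (`α i₁ i₁ j (0,0,0) = α i₁ i₁ j (0,0,1) = 0`, `j ∉ {i₀,i₁}` —
forced by a junk-free connection, tree file `…ConnectionArc`), the rows of `quadTerm 1 α X` at an
ARBITRARY shell `n` (gain `2^{5n/2}`) are:

* trigger row `(i₁,n)`: `2^{5n/2} · u_n · (e·x_n - g·x_{n+1})` with `e = d i₁ 0`, `g = α i₁ i₁ i₀ (0,0,1)`
  — growth on the own carrier, quenching by the carrier above, nothing else;
* junk rows `(j,n)`, `j ∉ {i₀,i₁}`: `2^{5n/2} · (α i₁ i₁ j (1,0,0) + α i₁ i₁ j (0,1,0)) · u_{n+1} · u_n`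
  — the OVERLAP-TRIAD LEAK: the sector `{i₀,i₁}` is invariant under the exact flow iff these two free
  coefficients vanish; no clause of the crux constrains them (they vanish on the connection `H`, which
  charges a trigger at one shell only).

(The carrier row `(i₀,n)` — signed squares only — is the sibling file `…CarrierRow`.) Also the rows of a
SEED-TYPE table `σ` (only (purity) and (parity) available, no saddle information): on sector families
its trigger row is `2^{5n/2}·(2s₀·x_n u_n + 2s″·x_n u_{n+1} + 2p·u_n x_{n+1}) + 2^{5(n-1)/2}·2s·x_{n-1}u_{n-1}`
with the seed `s = σ i₀ i₁ i₁ (0,0,1)`, the reverse seed `s″ = σ i₀ i₁ i₁ (0,1,0)`, `p = σ i₀ i₁ i₁ (1,0,0)`,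
`s₀ = σ i₀ i₁ i₁ (0,0,0)` (symmetric table).

HONEST FRAMING: finite algebra of structure constants of Tao-type MODEL lattices (Tao 2016 §4); helper
for the crux, no stub credit; nothing here is a statement about the Navier–Stokes equations; no summit,
rung or crux is proved by this file.
-/

noncomputable section

set_option linter.dupNamespace false

namespace Summit.NavierStokesRegularity.NavierStokesRegularity.Theorems

open Literature.Analysis.FluidPDE Literature.Analysis.FluidPDE.TaoCascade

/-- **Trigger row on sector families, any shell.** [this file] -/
theorem htcSR_quadTerm_trigger (α : Fin 4 → Fin 4 → Fin 4 → ℤ × ℤ × ℤ → ℝ) (i₀ i₁ : Fin 4)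
    (d : Fin 4 → ℤ → ℝ) (hne : i₀ ≠ i₁)
    (hsym : IsSymmetricCoeff α) (hcanc : IsCancellingCoeff α)
    (hpure : ∀ X : Fin 4 → ℤ → ℝ → ℝ, (∀ i n t, i ≠ i₀ → X i n t = 0) →
      ∀ i n t, quadTerm 1 α X i n t = 0)
    (hpar : ∀ (j₁ j₂ j₃ : Fin 4) (μ : ℤ × ℤ × ℤ), Xor (Xor (j₁ = i₁) (j₂ = i₁)) (j₃ = i₁) →
      α j₁ j₂ j₃ μ = 0)
    (hsad : ∀ (Y : Fin 4 → ℤ → ℝ → ℝ) (i : Fin 4) (n : ℤ) (t : ℝ),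
      quadTerm 1 α (fun j m s => (fun j m (_ : ℝ) => if j = i₀ ∧ m = 0 then (1 : ℝ) else 0) j m s +
          Y j m s) i n t -
        quadTerm 1 α (fun j m (_ : ℝ) => if j = i₀ ∧ m = 0 then (1 : ℝ) else 0) i n t -
        quadTerm 1 α Y i n t = d i n * Y i n t)
    (X : Fin 4 → ℤ → ℝ → ℝ) (t : ℝ) (hXs : ∀ j n, j ≠ i₀ → j ≠ i₁ → X j n t = 0) (n : ℤ) :
    quadTerm 1 α X i₁ n t = (1 + 1 : ℝ) ^ ((5 : ℝ) * n / 2) *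
      (X i₁ n t * (d i₁ 0 * X i₀ n t - α i₁ i₁ i₀ (0, 0, 1) * X i₀ (n + 1) t)) := by
  obtain ⟨-, nf2, -, nf4, -, -, -, -, nf9⟩ :=
    HeteroclinicTriggerChain.stub_normal_form α i₀ d hsym hcanc hpure hsad
  have m000 : ((0 : ℤ), (0 : ℤ), (0 : ℤ)) ∈ shiftSet := by decide
  -- a pair sum against a shift vanishes unless exactly one slot is the trigger and the other the carrier
  have hpair : ∀ (μ : ℤ × ℤ × ℤ) (m₁ m₂ : ℤ),
      ∑ a : Fin 4, ∑ b : Fin 4, α a b i₁ μ * (X a m₁ t * X b m₂ t) =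
        α i₀ i₁ i₁ μ * (X i₀ m₁ t * X i₁ m₂ t) + α i₁ i₀ i₁ μ * (X i₁ m₁ t * X i₀ m₂ t) := by
    intro μ m₁ m₂
    have key : ∀ a b : Fin 4, α a b i₁ μ * (X a m₁ t * X b m₂ t) =
        (if a = i₀ ∧ b = i₁ then α i₀ i₁ i₁ μ * (X i₀ m₁ t * X i₁ m₂ t) else 0) +
          (if a = i₁ ∧ b = i₀ then α i₁ i₀ i₁ μ * (X i₁ m₁ t * X i₀ m₂ t) else 0) := by
      intro a b
      by_cases ha1 : a = i₁
      · rw [ha1, if_neg (show ¬(i₁ = i₀ ∧ b = i₁) from fun h => hne h.1.symm), zero_add]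
        by_cases hb0 : b = i₀
        · rw [hb0, if_pos (show i₁ = i₁ ∧ i₀ = i₀ from ⟨rfl, rfl⟩)]
        · rw [if_neg (show ¬(i₁ = i₁ ∧ b = i₀) from fun h => hb0 h.2)]
          by_cases hb1 : b = i₁
          · rw [hb1, hpar i₁ i₁ i₁ μ (by simp [Xor]), zero_mul]
          · rw [hXs b m₂ hb0 hb1, mul_zero, mul_zero]
      · rw [if_neg (show ¬(a = i₁ ∧ b = i₀) from fun h => ha1 h.1), add_zero]
        by_cases ha0 : a = i₀
        · rw [ha0]
          by_cases hb1 : b = i₁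
          · rw [hb1, if_pos (show i₀ = i₀ ∧ i₁ = i₁ from ⟨rfl, rfl⟩)]
          · rw [if_neg (show ¬(i₀ = i₀ ∧ b = i₁) from fun h => hb1 h.2),
              hpar i₀ b i₁ μ (by simp [Xor, hne, hb1]), zero_mul]
        · rw [if_neg (show ¬(a = i₀ ∧ b = i₁) from fun h => ha0 h.1), hXs a m₁ ha0 ha1, zero_mul,
            mul_zero]
    rw [Finset.sum_congr rfl fun a _ => Finset.sum_congr rfl fun b _ => key a b]
    simp only [Finset.sum_add_distrib]
    rw [htcCA_sum_sum_ite_pair, htcCA_sum_sum_ite_pair]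
  rw [htcNF_quadTerm_expand]
  simp only [Finset.sum_add_distrib]
  rw [hpair (0, 0, 0) n n, hpair (1, 0, 0) (n + 1) n, hpair (0, 1, 0) n (n + 1),
    hpair (0, 0, 1) (n - 1) (n - 1)]
  obtain ⟨h001a, h001b, h100b, h010a⟩ := nf2 i₁ i₁
  obtain ⟨-, h100a, h010b, -⟩ := nf9 i₁
  have s0 := hsym i₁ i₀ i₁ 0 0 0 m000
  rw [h001a, h001b, h100b, h010a, h100a, h010b, nf4 i₁, s0]
  ring

/-- **Junk rows on sector families, any shell: the overlap-triad leak.** With no trigger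
self-interaction into the junk mode `j` (`α i₁ i₁ j (0,0,0) = α i₁ i₁ j (0,0,1) = 0`), the only force on
`(j,n)` from a sector family is `2^{5n/2}·(α i₁ i₁ j (1,0,0) + α i₁ i₁ j (0,1,0))·u_{n+1}·u_n`. [this file] -/
theorem htcSR_quadTerm_junk (α : Fin 4 → Fin 4 → Fin 4 → ℤ × ℤ × ℤ → ℝ) (i₀ i₁ : Fin 4)
    (d : Fin 4 → ℤ → ℝ) (hne : i₀ ≠ i₁)
    (hsym : IsSymmetricCoeff α) (hcanc : IsCancellingCoeff α)
    (hpure : ∀ X : Fin 4 → ℤ → ℝ → ℝ, (∀ i n t, i ≠ i₀ → X i n t = 0) →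
      ∀ i n t, quadTerm 1 α X i n t = 0)
    (hpar : ∀ (j₁ j₂ j₃ : Fin 4) (μ : ℤ × ℤ × ℤ), Xor (Xor (j₁ = i₁) (j₂ = i₁)) (j₃ = i₁) →
      α j₁ j₂ j₃ μ = 0)
    (hsad : ∀ (Y : Fin 4 → ℤ → ℝ → ℝ) (i : Fin 4) (n : ℤ) (t : ℝ),
      quadTerm 1 α (fun j m s => (fun j m (_ : ℝ) => if j = i₀ ∧ m = 0 then (1 : ℝ) else 0) j m s +
          Y j m s) i n t -
        quadTerm 1 α (fun j m (_ : ℝ) => if j = i₀ ∧ m = 0 then (1 : ℝ) else 0) i n t -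
        quadTerm 1 α Y i n t = d i n * Y i n t)
    (X : Fin 4 → ℤ → ℝ → ℝ) (t : ℝ) (hXs : ∀ j n, j ≠ i₀ → j ≠ i₁ → X j n t = 0)
    (j : Fin 4) (hj1 : j ≠ i₁)
    (hb0 : α i₁ i₁ j (0, 0, 0) = 0) (hb1 : α i₁ i₁ j (0, 0, 1) = 0) (n : ℤ) :
    quadTerm 1 α X j n t = (1 + 1 : ℝ) ^ ((5 : ℝ) * n / 2) *
      ((α i₁ i₁ j (1, 0, 0) + α i₁ i₁ j (0, 1, 0)) * (X i₁ (n + 1) t * X i₁ n t)) := by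
  obtain ⟨nf1, -, -, -, -, -, -, -, -⟩ :=
    HeteroclinicTriggerChain.stub_normal_form α i₀ d hsym hcanc hpure hsad
  -- a pair sum into a junk row reduces to the trigger-trigger entry
  have hpair : ∀ (μ : ℤ × ℤ × ℤ), μ ∈ shiftSet → ∀ (m₁ m₂ : ℤ),
      ∑ a : Fin 4, ∑ b : Fin 4, α a b j μ * (X a m₁ t * X b m₂ t) =
        α i₁ i₁ j μ * (X i₁ m₁ t * X i₁ m₂ t) := by
    intro μ hμ m₁ m₂
    have key : ∀ a b : Fin 4, α a b j μ * (X a m₁ t * X b m₂ t) =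
        if a = i₁ ∧ b = i₁ then α i₁ i₁ j μ * (X i₁ m₁ t * X i₁ m₂ t) else 0 := by
      intro a b
      by_cases ha1 : a = i₁
      · rw [ha1]
        by_cases hb1 : b = i₁
        · rw [hb1, if_pos ⟨rfl, rfl⟩]
        · rw [if_neg (fun h => hb1 h.2)]
          by_cases hb0 : b = i₀
          · rw [hb0, hpar i₁ i₀ j μ (by simp [Xor, hne, hj1]), zero_mul]
          · rw [hXs b m₂ hb0 hb1, mul_zero, mul_zero]
      · rw [if_neg (fun h => ha1 h.1)]
        by_cases ha0 : a = i₀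
        · rw [ha0]
          by_cases hb1 : b = i₁
          · rw [hb1, hpar i₀ i₁ j μ (by simp [Xor, hne, hj1]), zero_mul]
          · by_cases hb0 : b = i₀
            · rw [hb0, nf1 j μ hμ, zero_mul]
            · rw [hXs b m₂ hb0 hb1, mul_zero, mul_zero]
        · rw [hXs a m₁ ha0 ha1, zero_mul, mul_zero]
    rw [Finset.sum_congr rfl fun a _ => Finset.sum_congr rfl fun b _ => key a b,
      htcCA_sum_sum_ite_pair]
  rw [htcNF_quadTerm_expand]
  simp only [Finset.sum_add_distrib]
  rw [hpair (0, 0, 0) (by decide) n n, hpair (1, 0, 0) (by decide) (n + 1) n,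
    hpair (0, 1, 0) (by decide) n (n + 1), hpair (0, 0, 1) (by decide) (n - 1) (n - 1), hb0, hb1]
  ring

/-- **Pure rows vanish** for ANY symmetric table whose pure-`i₀` families are force-free (the (purity)
clause, e.g. for the seed table `σ` of the crux): `τ i₀ i₀ i μ = 0` on the shift set. [this file] -/
theorem htcSR_pureRows_zero (τ : Fin 4 → Fin 4 → Fin 4 → ℤ × ℤ × ℤ → ℝ) (i₀ : Fin 4)
    (hsym : IsSymmetricCoeff τ)
    (hpure : ∀ X : Fin 4 → ℤ → ℝ → ℝ, (∀ i n t, i ≠ i₀ → X i n t = 0) →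
      ∀ i n t, quadTerm 1 τ X i n t = 0)
    (i : Fin 4) (μ : ℤ × ℤ × ℤ) (hμ : μ ∈ shiftSet) : τ i₀ i₀ i μ = 0 := by
  have m100 : ((1 : ℤ), (0 : ℤ), (0 : ℤ)) ∈ shiftSet := by decide
  have pur000 : τ i₀ i₀ i (0, 0, 0) = 0 := by
    have h := hpure (fun j m _ => if j = i₀ ∧ m = 0 then (1 : ℝ) else 0)
      (by intro j n t hj; simp [hj]) i 0 0
    rw [htcNF_quadTerm_expand] at h
    simp only [Int.cast_zero, mul_zero, zero_div, Real.rpow_zero, one_mul, and_true] at h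
    norm_num at h
    simpa only [Finset.sum_ite_eq', Finset.sum_ite_eq, Finset.mem_univ, if_true] using h
  have pur001 : τ i₀ i₀ i (0, 0, 1) = 0 := by
    have h := hpure (fun j m _ => if j = i₀ ∧ m = 0 then (1 : ℝ) else 0)
      (by intro j n t hj; simp [hj]) i 1 0
    rw [htcNF_quadTerm_expand] at h
    simp only [Int.cast_one] at h
    norm_num at h
    simpa only [Finset.sum_ite_eq', Finset.sum_ite_eq, Finset.mem_univ, if_true] using h
  have pur100 : τ i₀ i₀ i (1, 0, 0) = 0 ∧ τ i₀ i₀ i (0, 1, 0) = 0 := by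
    have h := hpure (fun j m _ => if j = i₀ ∧ (m = 0 ∨ m = 1) then (1 : ℝ) else 0)
      (by intro j n t hj; simp [hj]) i 0 0
    rw [htcNF_quadTerm_expand] at h
    simp only [Int.cast_zero, mul_zero, zero_div, Real.rpow_zero, one_mul, and_true, true_or,
      mul_add, Finset.sum_add_distrib] at h
    norm_num at h
    have hs := hsym i₀ i₀ i 1 0 0 m100
    constructor <;> linarith [pur000]
  rcases (mem_shiftSet_iff μ).1 hμ with rfl | rfl | rfl | rfl
  · exact pur000
  · exact pur100.1
  · exact pur100.2
  · exact pur001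

/-- **Trigger row of an arbitrary parity-respecting table on sector families, any shell.** For a table `τ`
obeying only the (parity) clause (e.g. the seed table `σ`), on a family charging only `i₀, i₁`:
`quadTerm 1 τ X i₁ n = 2^{5n/2}·[(τ i₀ i₁ i₁ + τ i₁ i₀ i₁)(000)·x_n u_n + τ i₀ i₁ i₁ (100)·x_{n+1} u_n +
τ i₁ i₀ i₁ (100)·u_{n+1} x_n + τ i₀ i₁ i₁ (010)·x_n u_{n+1} + τ i₁ i₀ i₁ (010)·u_n x_{n+1}] +
2^{5(n-1)/2}·(τ i₀ i₁ i₁ + τ i₁ i₀ i₁)(001)·x_{n-1}u_{n-1}` — for `σ`: same-shell trigger-rate tweak, the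
transfer-type partner, the REVERSE SEED `x_n u_{n+1} → u_n`, and the SEED `x_{n-1}u_{n-1} → u_n`. [this file] -/
theorem htcSR_quadTerm_trigger_of_parity (τ : Fin 4 → Fin 4 → Fin 4 → ℤ × ℤ × ℤ → ℝ) (i₀ i₁ : Fin 4)
    (hne : i₀ ≠ i₁)
    (hpar : ∀ (j₁ j₂ j₃ : Fin 4) (μ : ℤ × ℤ × ℤ), Xor (Xor (j₁ = i₁) (j₂ = i₁)) (j₃ = i₁) →
      τ j₁ j₂ j₃ μ = 0)
    (X : Fin 4 → ℤ → ℝ → ℝ) (t : ℝ) (hXs : ∀ j n, j ≠ i₀ → j ≠ i₁ → X j n t = 0) (n : ℤ) :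
    quadTerm 1 τ X i₁ n t =
      (1 + 1 : ℝ) ^ ((5 : ℝ) * n / 2) *
        ((τ i₀ i₁ i₁ (0, 0, 0) + τ i₁ i₀ i₁ (0, 0, 0)) * (X i₀ n t * X i₁ n t) +
          τ i₀ i₁ i₁ (1, 0, 0) * (X i₀ (n + 1) t * X i₁ n t) +
          τ i₁ i₀ i₁ (1, 0, 0) * (X i₁ (n + 1) t * X i₀ n t) +
          τ i₀ i₁ i₁ (0, 1, 0) * (X i₀ n t * X i₁ (n + 1) t) +
          τ i₁ i₀ i₁ (0, 1, 0) * (X i₁ n t * X i₀ (n + 1) t)) +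
      (1 + 1 : ℝ) ^ ((5 : ℝ) * ((n : ℝ) - 1) / 2) *
        ((τ i₀ i₁ i₁ (0, 0, 1) + τ i₁ i₀ i₁ (0, 0, 1)) * (X i₀ (n - 1) t * X i₁ (n - 1) t)) := by
  have hpair : ∀ (μ : ℤ × ℤ × ℤ) (m₁ m₂ : ℤ),
      ∑ a : Fin 4, ∑ b : Fin 4, τ a b i₁ μ * (X a m₁ t * X b m₂ t) =
        τ i₀ i₁ i₁ μ * (X i₀ m₁ t * X i₁ m₂ t) + τ i₁ i₀ i₁ μ * (X i₁ m₁ t * X i₀ m₂ t) := by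
    intro μ m₁ m₂
    have key : ∀ a b : Fin 4, τ a b i₁ μ * (X a m₁ t * X b m₂ t) =
        (if a = i₀ ∧ b = i₁ then τ i₀ i₁ i₁ μ * (X i₀ m₁ t * X i₁ m₂ t) else 0) +
          (if a = i₁ ∧ b = i₀ then τ i₁ i₀ i₁ μ * (X i₁ m₁ t * X i₀ m₂ t) else 0) := by
      intro a b
      by_cases ha1 : a = i₁
      · rw [ha1, if_neg (show ¬(i₁ = i₀ ∧ b = i₁) from fun h => hne h.1.symm), zero_add]
        by_cases hb0 : b = i₀
        · rw [hb0, if_pos (show i₁ = i₁ ∧ i₀ = i₀ from ⟨rfl, rfl⟩)]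
        · rw [if_neg (show ¬(i₁ = i₁ ∧ b = i₀) from fun h => hb0 h.2)]
          by_cases hb1 : b = i₁
          · rw [hb1, hpar i₁ i₁ i₁ μ (by simp [Xor]), zero_mul]
          · rw [hXs b m₂ hb0 hb1, mul_zero, mul_zero]
      · rw [if_neg (show ¬(a = i₁ ∧ b = i₀) from fun h => ha1 h.1), add_zero]
        by_cases ha0 : a = i₀
        · rw [ha0]
          by_cases hb1 : b = i₁
          · rw [hb1, if_pos (show i₀ = i₀ ∧ i₁ = i₁ from ⟨rfl, rfl⟩)]
          · rw [if_neg (show ¬(i₀ = i₀ ∧ b = i₁) from fun h => hb1 h.2),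
              hpar i₀ b i₁ μ (by simp [Xor, hne, hb1]), zero_mul]
        · rw [if_neg (show ¬(a = i₀ ∧ b = i₁) from fun h => ha0 h.1), hXs a m₁ ha0 ha1, zero_mul,
            mul_zero]
    rw [Finset.sum_congr rfl fun a _ => Finset.sum_congr rfl fun b _ => key a b]
    simp only [Finset.sum_add_distrib]
    rw [htcCA_sum_sum_ite_pair, htcCA_sum_sum_ite_pair]
  rw [htcNF_quadTerm_expand]
  simp only [Finset.sum_add_distrib]
  rw [hpair (0, 0, 0) n n, hpair (1, 0, 0) (n + 1) n, hpair (0, 1, 0) n (n + 1),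
    hpair (0, 0, 1) (n - 1) (n - 1)]
  ring

/-- **Junk rows of an arbitrary parity-respecting table with vanishing pure rows, on sector families, any
shell**: `quadTerm 1 τ X j n = 2^{5n/2}·[τ i₁ i₁ j (000)·u_n² + (τ i₁ i₁ j (100) + τ i₁ i₁ j (010))·u_{n+1}u_n]
+ 2^{5(n-1)/2}·τ i₁ i₁ j (001)·u_{n-1}²` for `j ≠ i₁` — only the trigger's self-interaction rows and the
overlap triad reach a junk mode from the sector. [this file] -/
theorem htcSR_quadTerm_junk_of_parity (τ : Fin 4 → Fin 4 → Fin 4 → ℤ × ℤ × ℤ → ℝ) (i₀ i₁ : Fin 4)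
    (hne : i₀ ≠ i₁)
    (hpar : ∀ (j₁ j₂ j₃ : Fin 4) (μ : ℤ × ℤ × ℤ), Xor (Xor (j₁ = i₁) (j₂ = i₁)) (j₃ = i₁) →
      τ j₁ j₂ j₃ μ = 0)
    (X : Fin 4 → ℤ → ℝ → ℝ) (t : ℝ) (hXs : ∀ j n, j ≠ i₀ → j ≠ i₁ → X j n t = 0)
    (j : Fin 4) (hj1 : j ≠ i₁) (hpr : ∀ μ : ℤ × ℤ × ℤ, μ ∈ shiftSet → τ i₀ i₀ j μ = 0) (n : ℤ) :
    quadTerm 1 τ X j n t =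
      (1 + 1 : ℝ) ^ ((5 : ℝ) * n / 2) *
        (τ i₁ i₁ j (0, 0, 0) * X i₁ n t ^ 2 +
          (τ i₁ i₁ j (1, 0, 0) + τ i₁ i₁ j (0, 1, 0)) * (X i₁ (n + 1) t * X i₁ n t)) +
      (1 + 1 : ℝ) ^ ((5 : ℝ) * ((n : ℝ) - 1) / 2) * (τ i₁ i₁ j (0, 0, 1) * X i₁ (n - 1) t ^ 2) := by
  have hpair : ∀ (μ : ℤ × ℤ × ℤ), μ ∈ shiftSet → ∀ (m₁ m₂ : ℤ),
      ∑ a : Fin 4, ∑ b : Fin 4, τ a b j μ * (X a m₁ t * X b m₂ t) =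
        τ i₁ i₁ j μ * (X i₁ m₁ t * X i₁ m₂ t) := by
    intro μ hμ m₁ m₂
    have key : ∀ a b : Fin 4, τ a b j μ * (X a m₁ t * X b m₂ t) =
        if a = i₁ ∧ b = i₁ then τ i₁ i₁ j μ * (X i₁ m₁ t * X i₁ m₂ t) else 0 := by
      intro a b
      by_cases ha1 : a = i₁
      · rw [ha1]
        by_cases hb1 : b = i₁
        · rw [hb1, if_pos ⟨rfl, rfl⟩]
        · rw [if_neg (fun h => hb1 h.2)]
          by_cases hb0 : b = i₀
          · rw [hb0, hpar i₁ i₀ j μ (by simp [Xor, hne, hj1]), zero_mul]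
          · rw [hXs b m₂ hb0 hb1, mul_zero, mul_zero]
      · rw [if_neg (fun h => ha1 h.1)]
        by_cases ha0 : a = i₀
        · rw [ha0]
          by_cases hb1 : b = i₁
          · rw [hb1, hpar i₀ i₁ j μ (by simp [Xor, hne, hj1]), zero_mul]
          · by_cases hb0 : b = i₀
            · rw [hb0, hpr μ hμ, zero_mul]
            · rw [hXs b m₂ hb0 hb1, mul_zero, mul_zero]
        · rw [hXs a m₁ ha0 ha1, zero_mul, mul_zero]
    rw [Finset.sum_congr rfl fun a _ => Finset.sum_congr rfl fun b _ => key a b,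
      htcCA_sum_sum_ite_pair]
  rw [htcNF_quadTerm_expand]
  simp only [Finset.sum_add_distrib]
  rw [hpair (0, 0, 0) (by decide) n n, hpair (1, 0, 0) (by decide) (n + 1) n,
    hpair (0, 1, 0) (by decide) n (n + 1), hpair (0, 0, 1) (by decide) (n - 1) (n - 1)]
  ring

end Summit.NavierStokesRegularity.NavierStokesRegularity.Theorems

end
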